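import Summits.NavierStokesRegularity.NavierStokesRegularity.Theorems.SqueezeCycleStrainAlgebra
import HarnessLib

/-!
# Route `SqueezeCycle`, crux `ExtremalBiaxialitySubcritical` — the cubic production ceiling
# (line `quarter-bootstrap-pinning`, stub `stub_cubicProductionBound`)

Helper file for item `stmt-NavierStokesRegularity-11609`
(`Summit.NavierStokesRegularity.NavierStokesRegularity.Theses.SqueezeCycle.ExtremalBiaxialitySubcritical`).

Main result `stub_cubicProductionBound`: for a trace-free real `3 × 3` matrix `A` (velocity
gradient) put `S = ½(A + Aᵀ)`, let `μ₁ = eigenvalues₀ 1` be the middle one of Mathlib's antitone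
eigenvalues of `A + Aᵀ = 2S` (so the middle strain eigenvalue is `λ₂(S) = μ₁/2`) and
`σ = ∑ᵢⱼ Sᵢⱼ² = |S|²_F`. If `0 ≤ m`, `0 < K`, `6m² ≤ K²`, `μ₁ ≤ 2m` and `σ ≤ K²`, then
`−4 det S ≤ (2m − 4m³/K²) σ`.
This is the sharp production ceiling fed to the leaky quarter law with threshold
`b = m − 2m³/K²`; it is homogeneous of degree three in `(A, m, K)`.

Proof. By `production_identity`, `−4 det S = μ₁σ − ½μ₁³ = f(λ₂)` with `f(l) = 2lσ − 4l³`, and by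
`six_mul_midStrain_sq_le`, `(3/2)μ₁² ≤ σ`, i.e. `6λ₂² ≤ σ`. The rest is the one-variable estimate
`cubic_ceiling_of_midStrain_le` on real numbers:
* case `6m² ≤ σ`: `f(m) − f(λ₂) = 2(m − λ₂)(σ − 2(m² + mλ₂ + λ₂²)) ≥ 0` (both factors are
  nonnegative since `λ₂ ≤ m` and `m², λ₂² ≤ σ/6`), and `f(m) = 2mσ − 4m³ ≤ 2mσ − 4m³σ/K²` as
  `σ ≤ K²`, `m ≥ 0`;
* case `σ < 6m²`: with `l₀ = √(σ/6) ∈ [0, m]` one has `|λ₂| ≤ l₀`,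
  `f(l₀) − f(λ₂) = 4(l₀ − λ₂)²(2l₀ + λ₂) ≥ 0` and `f(l₀) = 8l₀³ ≤ g(l₀)σ ≤ g(m)σ`, where
  `g(x) = 2x − 4x³/K²` is nondecreasing on `6x² ≤ K²` and `g(l₀)σ − 8l₀³ = 4l₀³(1 − σ/K²) ≥ 0`.
-/

namespace Summit.NavierStokesRegularity.NavierStokesRegularity.Theorems

open scoped Matrix
open Matrix

/-! ### The one-variable estimate -/

/-- **The cubic ceiling on real numbers**: if `0 ≤ m`, `0 < K`, `6m² ≤ K²`, `μ ≤ 2m`, `σ ≤ K²`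
and `(3/2)μ² ≤ σ`, then `μσ − ½μ³ ≤ (2m − 4m³/K²)σ`. With `μ = 2λ₂` this is
`2λ₂σ − 4λ₂³ ≤ (2m − 4m³/K²)σ`: the cubic `l ↦ 2lσ − 4l³` is nondecreasing on `6l² ≤ σ`, so its
value at `λ₂` is at most its value at `min(m, √(σ/6))`, which is at most `(2m − 4m³/K²)σ`
(case `6m² ≤ σ` through `σ ≤ K²`; case `σ < 6m²` through the monotonicity of `x ↦ 2x − 4x³/K²`
on `6x² ≤ K²`). Sharp at `μ = 2m`, `σ = K²`. [folklore] -/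
theorem cubic_ceiling_of_midStrain_le {μ σ m K : ℝ} (hm : 0 ≤ m) (hK : 0 < K)
    (hmK : 6 * m ^ 2 ≤ K ^ 2) (hμ : μ ≤ 2 * m) (hσK : σ ≤ K ^ 2) (hμσ : (3 / 2) * μ ^ 2 ≤ σ) :
    μ * σ - (1 / 2) * μ ^ 3 ≤ (2 * m - 4 * m ^ 3 / K ^ 2) * σ := by
  have hK2 : 0 < K ^ 2 := by positivity
  -- clear the denominator `K²`
  rw [show (2 * m - 4 * m ^ 3 / K ^ 2) * σ = (2 * m * σ * K ^ 2 - 4 * m ^ 3 * σ) / K ^ 2 by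
      field_simp, le_div_iff₀ hK2]
  rcases le_or_gt (6 * m ^ 2) σ with hcase | hcase
  · -- case `6m² ≤ σ`: compare with the value at `m`
    have hbr : 0 ≤ σ - 2 * m ^ 2 - m * μ - μ ^ 2 / 2 := by nlinarith [sq_nonneg (m - μ / 2)]
    have h1 : 0 ≤ (2 * m - μ) * (σ - 2 * m ^ 2 - m * μ - μ ^ 2 / 2) :=
      mul_nonneg (by linarith) hbr
    nlinarith [mul_nonneg hK2.le h1, mul_nonneg (pow_nonneg hm 3) (sub_nonneg.2 hσK)]
  · -- case `σ < 6m²`: compare with the value at `l₀ = √(σ/6) ≤ m`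
    have hσ0 : 0 ≤ σ := by nlinarith [sq_nonneg μ]
    set l₀ := Real.sqrt (σ / 6) with hl₀_def
    have hl₀ : 0 ≤ l₀ := Real.sqrt_nonneg _
    have hl₀sq : l₀ ^ 2 = σ / 6 := Real.sq_sqrt (by positivity)
    have hσeq : σ = 6 * l₀ ^ 2 := by linarith
    obtain ⟨hμlo, hμhi⟩ :=
      abs_le_of_sq_le_sq' (show μ ^ 2 ≤ (2 * l₀) ^ 2 by nlinarith) (by linarith : (0 : ℝ) ≤ 2 * l₀)
    have hl₀m : l₀ ≤ m := by nlinarith [add_nonneg hl₀ hm]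
    -- `f(λ₂) ≤ f(l₀) = 8 l₀³`
    have ha : μ * σ - 1 / 2 * μ ^ 3 ≤ 8 * l₀ ^ 3 := by
      rw [hσeq]
      nlinarith [mul_nonneg (sq_nonneg (2 * l₀ - μ)) (by linarith : (0 : ℝ) ≤ 4 * l₀ + μ)]
    -- `8 l₀³ ≤ g(l₀) σ ≤ g(m) σ`, cleared of the denominator `K²`
    have hq : 0 ≤ K ^ 2 - 2 * (m ^ 2 + m * l₀ + l₀ ^ 2) := by
      nlinarith [mul_nonneg hl₀ (sub_nonneg.2 hl₀m), mul_nonneg hm (sub_nonneg.2 hl₀m)]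
    have hR : 0 ≤ 3 * m * K ^ 2 - 6 * m ^ 3 - 2 * l₀ * K ^ 2 := by
      nlinarith [mul_nonneg (sub_nonneg.2 hl₀m) hq,
        mul_nonneg hl₀ (show (0 : ℝ) ≤ K ^ 2 - 6 * l₀ ^ 2 by linarith)]
    have hb : 8 * l₀ ^ 3 * K ^ 2 ≤ 2 * m * σ * K ^ 2 - 4 * m ^ 3 * σ := by
      rw [hσeq]
      nlinarith [mul_nonneg (sq_nonneg l₀) hR]
    nlinarith [mul_le_mul_of_nonneg_right ha hK2.le]

/-! ### The stub -/

/-- **stub_cubicProductionBound** (line `quarter-bootstrap-pinning`) — the sharp cubic production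
ceiling under a middle-eigenvalue ceiling and a strain bound: for a trace-free real `3 × 3`
matrix `A` with `S = ½(A + Aᵀ)`, `μ₁ = eigenvalues₀ 1` of `A + Aᵀ` (so `λ₂(S) = μ₁/2`), if
`0 ≤ m`, `0 < K`, `6m² ≤ K²`, `μ₁ ≤ 2m` and `|S|²_F ≤ K²` then `−4 det S ≤ (2m − 4m³/K²)|S|²_F`.
Proof: `−4 det S = μ₁|S|² − ½μ₁³` (`production_identity`), `(3/2)μ₁² ≤ |S|²`
(`six_mul_midStrain_sq_le`), and the one-variable estimate `cubic_ceiling_of_midStrain_le`.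
Homogeneous of degree three, so it applies to the gauge gradient `(−t)∇u` as well as to `∇u`
with `(m, K) ↦ (m/(−t), K/(−t))`. [folklore] -/
theorem stub_cubicProductionBound :
    ∀ (A : Matrix (Fin 3) (Fin 3) ℝ) (m K : ℝ), A.trace = 0 → 0 ≤ m → 0 < K → 6 * m ^ 2 ≤ K ^ 2 → (Matrix.isHermitian_add_transpose_self A).eigenvalues₀ 1 ≤ 2 * m → (∑ i, ∑ j, (((1 / 2 : ℝ) • (A + Aᵀ)) i j) ^ 2) ≤ K ^ 2 → -4 * (((1 / 2 : ℝ) • (A + Aᵀ))).det ≤ (2 * m - 4 * m ^ 3 / K ^ 2) * (∑ i, ∑ j, (((1 / 2 : ℝ) • (A + Aᵀ)) i j) ^ 2) := by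
  intro A m K hA hm hK hmK hμ hσ
  rw [production_identity A hA]
  exact cubic_ceiling_of_midStrain_le hm hK hmK hμ hσ (six_mul_midStrain_sq_le A hA)

end Summit.NavierStokesRegularity.NavierStokesRegularity.Theorems
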